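import Mathlib
import HarnessLib

/-!
# Crux `DescentPerfectToAll` (stmt-ResolutionOfSingularities-0549) — NEGATION lens 6, generation 7 (res-B-lens-6 g7, 2026-08-29)
# Negation audit of the 4e re-cut (`X_perm` / `X44c`, clean-permissible principalization in dimension 3) and of
# res-B-princ3's corner-chain conjecture (memo `Cruxes/CleanModels/Lines/Sketch-memo-4e-cleanPermissible.md` rev 10 §4 (4′)/(γ)).

bears_on: LADDER-RESOLUTION:B · [OURS · CANDIDATE] counted 0 · nothing here proves resolution in characteristic `p`
(resolution in char `p` is NOT proved; rung B = `PerfectRes_p → ResolutionInChar p` stays open; it lives in dim ≥ 4) ·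
Hironaka 2017 is never cited as fact.  This file is a WORKFILE (it does not conclude the crux); nothing here is served to provers.

Kernel content (no `sorry`):

§1 `NoSwitch` — the algebraic core of «FORCED CORNER CHAINS NEVER SWITCH» (memo `NEGATION-lens6-g7.md` §3).  In a type-(i) cascade
  of the insertion strategy S* the directrix at the corner point `qᵢ` is `{Zᵢ = 0}` with `Zᵢ^μ ∝ in_μ(fᵢ)`, and the chart of the
  point blow-up toward the vertex `[T D]` (`x = x'w, y = y'w`) turns `in_μ(f) = (X+Y)^μ` into `in_μ(f₁) = (X'+Y')^μ + W·R`.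
  `directrix_coeff_eq_of_pow_eq` : if a linear form `aX + bY + γW` satisfies `(aX+bY+γW)^μ = c·((X+Y)^μ + W·R)` (`μ ≥ 1`,
  coefficients in a reduced commutative ring) then `a = b`; `directrix_coeff_ne_zero_of_pow_eq` : and `a ≠ 0` when `c ≠ 0`.
  Hence `Dir_{q_{i+1}} = {X'+Y'+γW = 0}` never contains the tangent `[1:0:0]` / `[0:1:0]` of a NEWER double curve
  `E_{qᵢ} ∩ H̃_a`, `E_{qᵢ} ∩ H̃_b`: the chain continues (iff `γ = 0`) along the SAME double curve `D`, and is finite unless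
  `J ⊆ 𝓘_D^μ` (princ3 (α)).  This settles princ3's (4′) and conjecture (γ) on paper; (5) (towers over created lines) stays open.

§2 `ConormalCharge` — the algebraic core of lens-6's INDEPENDENT proof of L7b («a regular curve becomes clean-permissible after
  finitely many point blow-ups at its point», memo §2; concurs with princ3 §3): `natCast_mul_add_mem_of_sub_pow_mem_sq` — for a
  derivation `D` with `D m = e·m` (Euler field `x_j ∂_j` on the clean monomial `m = ∏ x_i^{e_i}`, `e = e_j`), a prime `P ∌ m`
  (the ideal of the curve `C`, case «`C` lies in no charged clean component») and `G = U·m` with `G - c^p ∈ P²` in characteristic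
  `p`: `e·U + D U ∈ P`; `natCast_mem_of_sub_pow_mem_sq` — so `e ∈ 𝔪` once `D U ∈ 𝔪 ∌ U`, `P ≤ 𝔪`; `dvd_of_natCast_mem` — so
  `p ∣ e`.  Read contrapositively: if some exponent `e_j` is prime to `p`, the conormal class of `G - c^p` in `𝓘_C/𝓘_C²` is NONZERO,
  and then the representative `G - c^p` becomes `t^{n+r}·L` with `L` a regular parameter through the strict transform after `n > r`
  point blow-ups — ADAPTED, exponent `1`: clean-permissible (memo §2; scheme-side bookkeeping not typed here).
§4 `VertexLemma` (rev 3, memo §4.12 (R3)/(R4)) — the algebraic cores of the VERTEX LEMMA and of «RESETS ARE TILTED».  On a near line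
  `ℓ_y ≅ ℙ¹` with side points `s_T, s_A, s_B` and charges `e_T, e_A, e_B` summing to `0` in `k`, births / resets are the critical points of
  `U′|_ℓ ∝ ∏ (s - s_side)^{e_side}` off the sides.  `derivative_two_sided` : with two sides `((X - sT)^(m+1) (X - sA)^(n+1))′ =
  (m+1)(sT - sA)·(X - sT)^m (X - sA)^n` when `(m+1) + (n+1) = 0` in `k`; `eval_derivative_two_sided_ne_zero` : so there is NO critical
  point off the two side points (`sT ≠ sA`, `m + 1 ≢ 0`); `reset_tilted` : the case `(1, p-1)` in characteristic `p` — a reset point that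
  is not a birth is never a critical point, i.e. the renormalised leaf is TILTED there (R4).  `three_sided_numerator_eq` : with three
  sides the numerator of the logarithmic derivative is LINEAR (at most one critical point: the birth); `three_sided_vertex`,
  `three_sided_vertex_no_root` : if the `B`-side point coincides with the leaf point (the near line passes through a VERTEX of the
  side triangle) the numerator is `(e_T + e_B)(s_T - s_A)·(X - s_T)`, whose only root is a side point — NO birth (R3).  Pure algebra;
  the geometric input (which side points coincide, by the trace rule (R1)) is in the memo.
§5 `CensusArithmetic` (rev 4, memo §4.15 (R16)) — corner charges `(1, 2j−1, 2j−2)` sum to `2(2j−1)`: uncharged iff `E_{x_j}` is (odd `p`),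
then two sides cancel; a `δ = 2` level polynomial is quadratic: ≤ 1 critical point, none with `λ ≠ 0` after a tangential crossing.
-/

noncomputable section

set_option linter.dupNamespace false -- mandated namespace of this single-conjunct summit

namespace Summit.ResolutionOfSingularities.ResolutionOfSingularities.Cruxes.DescentPerfectToAll.NegationLens6g7

/-! ## §1  No switching of forced corner chains: the directrix keeps equal, non-zero `X`/`Y` coefficients -/
section NoSwitch

open MvPolynomial

variable {k : Type*} [CommRing k]

/-- Evaluation of the linear form `aX₀ + bX₁ + γX₂` at a point. -/
theorem eval_linearForm (v : Fin 3 → k) (a b γ : k) :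
    MvPolynomial.eval v (C a * X 0 + C b * X 1 + C γ * X 2) = a * v 0 + b * v 1 + γ * v 2 := by
  simp [map_add, map_mul, eval_C, eval_X]

/-- Evaluation of the right-hand side `c·((X₀+X₁)^μ + X₂·R)` at a point with `v 0 + v 1 = 0`, `v 2 = 0` (`μ ≥ 1`). -/
theorem eval_rhs_eq_zero (v : Fin 3 → k) (c : k) (μ : ℕ) (hμ : 0 < μ) (R : MvPolynomial (Fin 3) k)
    (h01 : v 0 + v 1 = 0) (h2 : v 2 = 0) :
    MvPolynomial.eval v (C c * ((X 0 + X 1) ^ μ + X 2 * R)) = 0 := by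
  simp [map_add, map_mul, map_pow, eval_C, eval_X, h01, h2, zero_pow (Nat.pos_iff_ne_zero.mp hμ)]

/-- **No-switch lemma, part 1.**  If `(aX+bY+γW)^μ = c·((X+Y)^μ + W·R)` with `μ ≥ 1` over a reduced commutative ring, then
`a = b`.  Proof: evaluate at `(X,Y,W) = (1,-1,0)`, where the right-hand side vanishes: `(a-b)^μ = 0`. -/
theorem directrix_coeff_eq_of_pow_eq [IsReduced k] (a b γ c : k) (μ : ℕ) (hμ : 0 < μ)
    (R : MvPolynomial (Fin 3) k)
    (h : (C a * X 0 + C b * X 1 + C γ * X 2) ^ μ = C c * ((X 0 + X 1) ^ μ + X 2 * R)) :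
    a = b := by
  set v : Fin 3 → k := ![(1 : k), -1, 0] with hv
  have hv0 : v 0 = 1 := rfl
  have hv1 : v 1 = -1 := rfl
  have hv2 : v 2 = 0 := rfl
  have hev := congrArg (MvPolynomial.eval v) h
  rw [map_pow, eval_linearForm, eval_rhs_eq_zero v c μ hμ R (by rw [hv0, hv1]; ring) hv2, hv0, hv1, hv2] at hev
  have hzero : (a - b) ^ μ = 0 := by
    have e1 : a * 1 + b * -1 + γ * 0 = a - b := by ring
    rw [e1] at hev
    exact hev
  have hab : a - b = 0 := IsReduced.eq_zero _ ⟨μ, hzero⟩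
  exact sub_eq_zero.mp hab

/-- **No-switch lemma, part 2.**  Under the same identity with `μ ≥ 1`, `c ≠ 0` forces `a ≠ 0` (evaluate at `(1,0,0)`:
`a^μ = c`); with part 1, `b ≠ 0` as well.  So the directrix form `aX + bY + γW` is never a form in `X, W` alone or in `Y, W`
alone: the line `Proj(Dir) ⊂ E ≅ ℙ²` misses the vertices `[1:0:0]` and `[0:1:0]` of the coordinate triangle. -/
theorem directrix_coeff_ne_zero_of_pow_eq (a b γ c : k) (μ : ℕ) (hμ : 0 < μ)
    (R : MvPolynomial (Fin 3) k)
    (h : (C a * X 0 + C b * X 1 + C γ * X 2) ^ μ = C c * ((X 0 + X 1) ^ μ + X 2 * R)) (hc : c ≠ 0) :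
    a ≠ 0 := by
  set v : Fin 3 → k := ![(1 : k), 0, 0] with hv
  have hv0 : v 0 = 1 := rfl
  have hv1 : v 1 = 0 := rfl
  have hv2 : v 2 = 0 := rfl
  have hev := congrArg (MvPolynomial.eval v) h
  rw [map_pow, eval_linearForm] at hev
  simp only [map_mul, map_add, map_pow, eval_C, eval_X, hv0, hv1, hv2, mul_one, mul_zero, add_zero, one_pow,
    zero_mul] at hev
  -- hev : a ^ μ = c
  intro ha0
  apply hc
  rw [← hev, ha0, zero_pow (Nat.pos_iff_ne_zero.mp hμ)]

/-- **No-switch lemma, part 3 (continuation).**  If moreover `γ = 0` (the chain continues toward the vertex `[0:0:1] = [T D]`)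
and `k` is a domain, then `R = 0` and the new initial form is again an exact `μ`-th power of `X + Y` up to the scalar `c = a^μ`:
the induction hypothesis «`in_μ(f) = (X+Y)^μ` in the trihedron `(H̃_a, H̃_b, E_last)`» reproduces itself at the next corner. -/
theorem rhs_rem_eq_zero_of_pow_eq [IsDomain k] (a b c : k) (μ : ℕ) (hμ : 0 < μ)
    (R : MvPolynomial (Fin 3) k)
    (h : (C a * X 0 + C b * X 1 + C (0 : k) * X 2) ^ μ = C c * ((X 0 + X 1) ^ μ + X 2 * R)) (hc : c ≠ 0) :
    c = a ^ μ ∧ R = 0 := by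
  have hab : a = b := directrix_coeff_eq_of_pow_eq a b 0 c μ hμ R h
  subst hab
  have hlin : C a * X 0 + C a * X 1 + C (0 : k) * X 2 = C a * (X 0 + X 1 : MvPolynomial (Fin 3) k) := by
    simp [mul_add]
  rw [hlin, mul_pow, ← map_pow] at h
  -- h : C (a^μ) * (X 0 + X 1)^μ = C c * ((X 0 + X 1)^μ + X 2 * R)
  have hc' : c = a ^ μ := by
    have hev := congrArg (MvPolynomial.eval (![(1 : k), 0, 0])) h
    have e0 : (![(1 : k), 0, 0] : Fin 3 → k) 0 = 1 := rfl
    have e1 : (![(1 : k), 0, 0] : Fin 3 → k) 1 = 0 := rfl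
    have e2 : (![(1 : k), 0, 0] : Fin 3 → k) 2 = 0 := rfl
    simp only [map_mul, map_add, map_pow, eval_C, eval_X, e0, e1, e2, add_zero, one_pow, mul_one, zero_mul] at hev
    exact hev.symm
  refine ⟨hc', ?_⟩
  subst hc'
  -- cancel `C (a^μ) * (X 0 + X 1)^μ` on both sides
  have h' : C (a ^ μ) * (X 2 * R) = 0 := by
    have := h
    rw [mul_add] at this
    -- this : C (a^μ) * (X 0 + X 1)^μ = C (a^μ) * (X 0 + X 1)^μ + C (a^μ) * (X 2 * R)
    have h2 : C (a ^ μ) * (X 0 + X 1) ^ μ + C (a ^ μ) * (X 2 * R) = C (a ^ μ) * (X 0 + X 1) ^ μ + 0 := by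
      rw [add_zero]; exact this.symm
    exact add_left_cancel h2
  have hCne : (C (a ^ μ) : MvPolynomial (Fin 3) k) ≠ 0 := by
    rw [Ne, C_eq_zero]; exact hc
  have hX2 : (X 2 : MvPolynomial (Fin 3) k) ≠ 0 := X_ne_zero 2
  rcases mul_eq_zero.mp h' with h0 | h0
  · exact absurd h0 hCne
  · rcases mul_eq_zero.mp h0 with h1 | h1
    · exact absurd h1 hX2
    · exact h1

end NoSwitch

/-! ## §2  Conormal charge: in the case «`C` in no charged clean component», `G ≡ c^p (mod 𝓘_C²)` forces `p ∣` every exponent -/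
section ConormalCharge

variable {R : Type*} [CommRing R]

/-- A derivation maps `P²` into `P` for any ideal `P` (Leibniz). -/
theorem derivation_apply_mem_of_mem_sq (D : Derivation ℤ R R) (P : Ideal R) {x : R} (hx : x ∈ P ^ 2) :
    D x ∈ P := by
  rw [pow_two] at hx
  refine Submodule.mul_induction_on hx ?_ ?_
  · intro a ha b hb
    rw [Derivation.leibniz]
    exact P.add_mem (P.mul_mem_right _ ha) (P.mul_mem_right _ hb)
  · intro x y hx hy
    rw [map_add]
    exact P.add_mem hx hy

/-- In characteristic `p`, a derivation kills `p`-th powers. -/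
theorem derivation_apply_pow_char (p : ℕ) [CharP R p] (D : Derivation ℤ R R) (c : R) : D (c ^ p) = 0 := by
  rw [Derivation.leibniz_pow, nsmul_eq_mul, CharP.cast_eq_zero R p, zero_mul]

/-- **Conormal charge, step A.**  `D m = e·m`, `P` prime with `m ∉ P`, `G = U·m`, `G - c^p ∈ P²`, characteristic `p`
⟹ `e·U + D U ∈ P`.  (Euler field `D = x_j ∂_j` on the clean monomial `m`, `e = e_j`; `P = 𝓘_C`.) -/
theorem natCast_mul_add_mem_of_sub_pow_mem_sq (p : ℕ) [CharP R p] (D : Derivation ℤ R R) (P : Ideal R) [P.IsPrime]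
    (U m c G : R) (e : ℕ) (hG : G = U * m) (hDm : D m = (e : R) * m) (hm : m ∉ P) (hGc : G - c ^ p ∈ P ^ 2) :
    (e : R) * U + D U ∈ P := by
  have h1 : D (G - c ^ p) ∈ P := derivation_apply_mem_of_mem_sq D P hGc
  rw [map_sub, derivation_apply_pow_char p D c, sub_zero, hG, Derivation.leibniz, hDm, smul_eq_mul, smul_eq_mul] at h1
  -- h1 : U * (↑e * m) + m * D U ∈ P
  have h2 : m * ((e : R) * U + D U) ∈ P := by
    have : U * ((e : R) * m) + m * D U = m * ((e : R) * U + D U) := by ring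
    rw [this] at h1; exact h1
  exact ((Ideal.IsPrime.mem_or_mem ‹P.IsPrime› h2).resolve_left hm)

/-- **Conormal charge, step B.**  If moreover `P ≤ 𝔪`, `𝔪` prime, `D U ∈ 𝔪` (the Euler field vanishes at the point) and
`U ∉ 𝔪` (a unit), then `(e : R) ∈ 𝔪`. -/
theorem natCast_mem_of_sub_pow_mem_sq (p : ℕ) [CharP R p] (D : Derivation ℤ R R) (P 𝔪 : Ideal R) [P.IsPrime]
    [𝔪.IsPrime] (hP𝔪 : P ≤ 𝔪) (U m c G : R) (e : ℕ) (hG : G = U * m) (hDm : D m = (e : R) * m) (hm : m ∉ P)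
    (hGc : G - c ^ p ∈ P ^ 2) (hDU : D U ∈ 𝔪) (hU : U ∉ 𝔪) :
    (e : R) ∈ 𝔪 := by
  have hA : (e : R) * U + D U ∈ 𝔪 := hP𝔪 (natCast_mul_add_mem_of_sub_pow_mem_sq p D P U m c G e hG hDm hm hGc)
  have hB : (e : R) * U ∈ 𝔪 := by
    have : (e : R) * U = ((e : R) * U + D U) - D U := by ring
    rw [this]; exact 𝔪.sub_mem hA hDU
  exact ((Ideal.IsPrime.mem_or_mem ‹𝔪.IsPrime› hB).resolve_right hU)

/-- **Conormal charge, step C.**  In characteristic `p` (prime), a natural number lying in a proper ideal is divisible by `p`. -/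
theorem dvd_of_natCast_mem (p : ℕ) [Fact p.Prime] [CharP R p] (𝔪 : Ideal R) (h𝔪 : 𝔪 ≠ ⊤) (e : ℕ)
    (he : (e : R) ∈ 𝔪) : p ∣ e := by
  by_contra hnd
  have hne : ((e : ZMod p)) ≠ 0 := by
    rw [Ne, CharP.cast_eq_zero_iff (ZMod p) p e]; exact hnd
  have hu : IsUnit ((e : ZMod p)) := isUnit_iff_ne_zero.mpr hne
  have hu' : IsUnit ((e : R)) := by
    have := hu.map (ZMod.castHom (dvd_refl p) R)
    simpa using this
  exact h𝔪 (𝔪.eq_top_of_isUnit_mem he hu')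

/-- **Conormal charge (assembled).**  In the situation of step B with `p` prime: `p ∣ e`.  Applied to each Euler field
`x_j ∂_j` (`j = 1,2,3`) of a clean monomial `G = U·∏ x_i^{e_i}` at a closed point `q` of a regular curve `C` contained in no
`V(x_i)` with `e_i ≢ 0`: «`G ≡ c^p (mod 𝓘_C²)`» forces `p ∣ e_j` for all `j` — impossible for a clean form (1) representative.
Hence the conormal class of `G - c^p` is non-zero and L7b follows at `q` after finitely many point blow-ups (memo §2). -/
theorem dvd_charge_of_sub_pow_mem_sq (p : ℕ) [Fact p.Prime] [CharP R p] (D : Derivation ℤ R R) (P 𝔪 : Ideal R)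
    [P.IsPrime] [𝔪.IsPrime] (hP𝔪 : P ≤ 𝔪) (U m c G : R) (e : ℕ) (hG : G = U * m) (hDm : D m = (e : R) * m)
    (hm : m ∉ P) (hGc : G - c ^ p ∈ P ^ 2) (hDU : D U ∈ 𝔪) (hU : U ∉ 𝔪) : p ∣ e :=
  dvd_of_natCast_mem p 𝔪 (Ideal.IsPrime.ne_top ‹𝔪.IsPrime›) e
    (natCast_mem_of_sub_pow_mem_sq p D P 𝔪 hP𝔪 U m c G e hG hDm hm hGc hDU hU)

end ConormalCharge

/-! ## §3  Tower sections avoid the mother plane (memo rev 2 §4.4, LEMMA T)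

Along a created line `L ⊂ E_q` one has `f = v^μ + w·R` with `w` the equation of the mother plane `E_q` and the coefficient
of `v^μ w^0` a UNIT `λ` (identically `1` at level one).  In the chart `w = w′v` of the blow-up of `L`, the restriction of the
weak transform to the exceptional divisor is a polynomial `P_s(w′)` of degree `≤ μ` in the fibre coordinate with constant term
`λ(s)`; a near point at `w′ = w₀` over `s` forces `(w′ - w₀)^μ ∣ P_s`, hence `P_s = c·(w′ - w₀)^μ`, and evaluating at `w′ = 0`
gives `w₀ ≠ 0`: the near section never meets the strict transform `{w′ = 0}` of the mother plane.  The two algebraic steps: -/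
section TowerSection

open Polynomial

variable {k : Type*} [CommRing k] [IsDomain k]

/-- A polynomial of degree `≤ μ` divisible by `(X - w₀)^μ` is a constant multiple of it. -/
theorem eq_C_mul_X_sub_C_pow_of_dvd (P : k[X]) (w₀ : k) (μ : ℕ) (hdeg : P.natDegree ≤ μ)
    (hdvd : (X - C w₀) ^ μ ∣ P) : ∃ c : k, P = C c * (X - C w₀) ^ μ := by
  obtain ⟨Q, rfl⟩ := hdvd
  by_cases hQ : Q = 0
  · exact ⟨0, by simp [hQ]⟩
  have hB : (X - C w₀) ^ μ ≠ 0 := pow_ne_zero _ (X_sub_C_ne_zero w₀)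
  have hdegB : ((X - C w₀) ^ μ).natDegree = μ := by
    rw [natDegree_pow, natDegree_X_sub_C, mul_one]
  have hsum : ((X - C w₀) ^ μ * Q).natDegree = μ + Q.natDegree := by
    rw [natDegree_mul hB hQ, hdegB]
  have hQ0 : Q.natDegree = 0 := by
    rw [hsum] at hdeg; omega
  refine ⟨Q.coeff 0, ?_⟩
  conv_lhs => rw [eq_C_of_natDegree_eq_zero hQ0]
  ring

/-- **LEMMA T, algebraic core.**  If `P` has degree `≤ μ` (`0 < μ`), is divisible by `(X - w₀)^μ` (a near point of order `μ`
at `w′ = w₀` in the fibre) and has a non-zero constant term (the unit coefficient `λ` of `v^μ`), then `w₀ ≠ 0`: the near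
point is off the mother plane `{w′ = 0}`. -/
theorem near_root_ne_zero (P : k[X]) (w₀ : k) (μ : ℕ) (hμ : 0 < μ) (hdeg : P.natDegree ≤ μ)
    (hdvd : (X - C w₀) ^ μ ∣ P) (h0 : P.eval 0 ≠ 0) : w₀ ≠ 0 := by
  obtain ⟨c, hc⟩ := eq_C_mul_X_sub_C_pow_of_dvd P w₀ μ hdeg hdvd
  intro hw
  apply h0
  rw [hc, hw, map_zero, sub_zero, eval_mul, eval_C, eval_pow, eval_X, zero_pow hμ.ne', mul_zero]

end TowerSection


/-! ## §4  Vertex lemma and «resets are tilted» (memo rev 7 §4.12 (R3), (R4)): critical points of `∏ (X - s_side)^{e_side}` -/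
section VertexLemma

open Polynomial

variable {k : Type*} [Field k]



/-- (R3)/(R4) core: the derivative of a two-sided product `(X - sT)^(m+1) (X - sA)^(n+1)` whose exponents sum to
zero in `k` is `(m+1)(sT - sA) · (X - sT)^m (X - sA)^n` — it has NO root off the two side points when `sT ≠ sA` and
`(m+1 : k) ≠ 0`. -/
theorem derivative_two_sided (m n : ℕ) (sT sA : k) (h : ((m + 1 : ℕ) : k) + ((n + 1 : ℕ) : k) = 0) :
    derivative ((X - C sT) ^ (m + 1) * (X - C sA) ^ (n + 1))
      = C (((m + 1 : ℕ) : k) * (sT - sA)) * (X - C sT) ^ m * (X - C sA) ^ n := by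
  have h' : ((m + 1 : ℕ) : k[X]) + ((n + 1 : ℕ) : k[X]) = 0 := by
    rw [← map_natCast C, ← map_natCast C (n+1), ← map_add, h, map_zero]
  simp only [derivative_mul, derivative_pow_succ, derivative_X, derivative_C, sub_zero, mul_one,
    map_mul, map_sub, map_add, map_one, map_natCast]
  push_cast at h' ⊢
  linear_combination ((X - C sT) ^ m * (X - C sA) ^ n * (X - C sT)) * h'

theorem eval_derivative_two_sided_ne_zero (m n : ℕ) (sT sA s : k)
    (h : ((m + 1 : ℕ) : k) + ((n + 1 : ℕ) : k) = 0) (hm : ((m + 1 : ℕ) : k) ≠ 0)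
    (hTA : sT ≠ sA) (hT : s ≠ sT) (hA : s ≠ sA) :
    eval s (derivative ((X - C sT) ^ (m + 1) * (X - C sA) ^ (n + 1))) ≠ 0 := by
  rw [derivative_two_sided m n sT sA h]
  simp only [eval_mul, eval_C, eval_pow, eval_sub, eval_X]
  refine mul_ne_zero (mul_ne_zero (mul_ne_zero hm (sub_ne_zero.mpr hTA)) (pow_ne_zero _ (sub_ne_zero.mpr hT)))
    (pow_ne_zero _ (sub_ne_zero.mpr hA))

/-- (R4) RESETS ARE TILTED: in characteristic `p`, `(X - sT)(X - sA)^(p-1)` has no critical point off the sides. -/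
theorem reset_tilted (p : ℕ) [hp : Fact p.Prime] [CharP k p] (sT sA s : k)
    (hTA : sT ≠ sA) (hT : s ≠ sT) (hA : s ≠ sA) :
    eval s (derivative ((X - C sT) ^ 1 * (X - C sA) ^ (p - 1))) ≠ 0 := by
  obtain ⟨q, hq⟩ : ∃ q, p - 1 = q + 1 := ⟨p - 2, by have := hp.out.two_le; omega⟩
  rw [hq]
  refine eval_derivative_two_sided_ne_zero 0 q sT sA s ?_ ?_ hTA hT hA
  · have : (0 + 1 : ℕ) + (q + 1) = p := by have := hp.out.two_le; omega
    rw [← Nat.cast_add, this, CharP.cast_eq_zero]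
  · simp

/-- (R3) three sides: the numerator of the logarithmic derivative of `(X-sT)^eT (X-sA)^eA (X-sB)^eB` is LINEAR when
the exponents sum to zero in `k` (so a 3-sided near line carries at most one critical point off the sides). -/
theorem three_sided_numerator_eq (eT eA eB : k) (sT sA sB : k) (h : eT + eA + eB = 0) :
    C eT * (X - C sA) * (X - C sB) + C eA * (X - C sT) * (X - C sB) + C eB * (X - C sT) * (X - C sA)
      = C (-(eT * (sA + sB) + eA * (sT + sB) + eB * (sT + sA))) * X
        + C (eT * sA * sB + eA * sT * sB + eB * sT * sA) := by
  have h' : C eT + C eA + C eB = (0 : k[X]) := by rw [← map_add, ← map_add, h, map_zero]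
  simp only [map_neg, map_add, map_mul]
  linear_combination (X ^ 2) * h'

/-- (R3) VERTEX case: if the `B`-side point coincides with the leaf point (`sB = sT`), the numerator is
`(eT + eB)(sT - sA) · (X - sT)`: its only root is the side point `sT` itself — NO birth. -/
theorem three_sided_vertex (eT eA eB : k) (sT sA : k) (h : eT + eA + eB = 0) :
    C eT * (X - C sA) * (X - C sT) + C eA * (X - C sT) * (X - C sT) + C eB * (X - C sT) * (X - C sA)
      = C ((eT + eB) * (sT - sA)) * (X - C sT) := by
  have h' : C eT + C eA + C eB = (0 : k[X]) := by rw [← map_add, ← map_add, h, map_zero]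
  simp only [map_add, map_mul, map_sub]
  linear_combination ((X - C sT) * (X - C sT)) * h'

theorem three_sided_vertex_no_root (eT eA eB : k) (sT sA s : k) (h : eT + eA + eB = 0)
    (hTB : eT + eB ≠ 0) (hTA : sT ≠ sA) (hs : s ≠ sT) :
    eval s (C eT * (X - C sA) * (X - C sT) + C eA * (X - C sT) * (X - C sT) + C eB * (X - C sT) * (X - C sA)) ≠ 0 := by
  rw [three_sided_vertex eT eA eB sT sA h]
  simp only [eval_mul, eval_C, eval_sub, eval_X]
  exact mul_ne_zero (mul_ne_zero hTB (sub_ne_zero.mpr hTA)) (sub_ne_zero.mpr hs)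

end VertexLemma

/-! ## §5 Arithmetic skeleton of (R15)–(R16) (memo §4.15, rev 11)

The census of the `κ = 2` sub-world rests on three small certainties recorded here:
* the corner point `q_j = K_{x_j} ∩ ℙ(T Ẽ_{Y_{j-2}})` carries the charges `(1, 2j-1, 2j-2)` whose sum is
  `2 · (2j - 1)`, so in odd characteristic its level is uncharged exactly when `E_{x_j}` (charge `2j-1`) is,
  and then only two charged sides remain (`corner_charge_sum`, `corner_uncharged_iff`);
* on a tower level with `δ = 2` the section polynomial `λ` is quadratic, its derivative is linear, so a level
  carries at most one critical point (`quadratic_critical_unique`), and after a TANGENTIAL crossing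
  (`λ = a (u - u₀)^2`) the only critical point is the crossing itself, where `λ = 0` — no `Γ`-birth
  (`tangential_no_birth`). -/
section CensusArithmetic

variable {k : Type*} [Field k]

/-- charges at the mixed corner `q_j`: leaf `1`, `E_{x_j}` `2j-1`, `Ẽ_{Y_{j-2}}` `2j-2`. -/
theorem corner_charge_sum (j : ℤ) : (1 : ℤ) + (2 * j - 1) + (2 * j - 2) = 2 * (2 * j - 1) := by ring

/-- In a field where `2 ≠ 0` the corner level is uncharged iff `E_{x_j}` is. -/
theorem corner_uncharged_iff (h2 : (2 : k) ≠ 0) (x : k) :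
    (1 : k) + (2 * x - 1) + (2 * x - 2) = 0 ↔ 2 * x - 1 = 0 := by
  have : (1 : k) + (2 * x - 1) + (2 * x - 2) = 2 * (2 * x - 1) := by ring
  rw [this, mul_eq_zero, or_iff_right h2]

/-- `ZMod p` for an odd prime `p` has `2 ≠ 0`. -/
theorem two_ne_zero_zmod (p : ℕ) [hp : Fact p.Prime] (hodd : p ≠ 2) : (2 : ZMod p) ≠ 0 := by
  intro h
  have h' : ((2 : ℕ) : ZMod p) = 0 := by exact_mod_cast h
  rw [ZMod.natCast_eq_zero_iff] at h'
  have := (Nat.prime_dvd_prime_iff_eq hp.out Nat.prime_two).mp h'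
  exact hodd this

/-- the corner statement in `ZMod p`, `p` an odd prime (p = 3: `j = 2`, sides `(1,2)`; p = 5: `j = 3`, sides `(1,4)`). -/
theorem corner_uncharged_iff_zmod (p : ℕ) [Fact p.Prime] (hodd : p ≠ 2) (j : ZMod p) :
    (1 : ZMod p) + (2 * j - 1) + (2 * j - 2) = 0 ↔ 2 * j - 1 = 0 :=
  corner_uncharged_iff (two_ne_zero_zmod p hodd) j

/-- when the corner level is uncharged the two remaining charged sides `1` and `2j-2` sum to zero
(the two-sided, critical-point-free configuration of `derivative_two_sided`). -/
theorem corner_two_sides_cancel (x : k) (hx : 2 * x - 1 = 0) : (1 : k) + (2 * x - 2) = 0 := by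
  linear_combination hx

/-- a quadratic's derivative `2 a u + b` has at most one zero when `2a ≠ 0`: at most one `Γ`-birth per `δ = 2` level. -/
theorem quadratic_critical_unique (a b u₁ u₂ : k) (ha : (2 : k) * a ≠ 0)
    (h₁ : 2 * a * u₁ + b = 0) (h₂ : 2 * a * u₂ + b = 0) : u₁ = u₂ := by
  have : 2 * a * (u₁ - u₂) = 0 := by linear_combination h₁ - h₂
  rcases mul_eq_zero.mp this with h | h
  · exact absurd h ha
  · exact sub_eq_zero.mp h

/-- after a tangential crossing `λ = a (u - u₀)^2` the unique critical point is `u₀`, where `λ` vanishes: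
no `Γ`-birth (a birth needs `λ ≠ 0` at the critical point). -/
theorem tangential_no_birth (a u₀ u : k) (ha : (2 : k) * a ≠ 0)
    (hcrit : 2 * a * (u - u₀) = 0) : a * (u - u₀) ^ 2 = 0 := by
  rcases mul_eq_zero.mp hcrit with h | h
  · exact absurd h ha
  · rw [h]; ring

open Polynomial in
/-- the derivative of the level polynomial `C a * X^2 + C b * X + C c` is the linear `C (2a) X + C b`. -/
theorem derivative_quadratic (a b c : k) :
    derivative (C a * X ^ 2 + C b * X + C c) = C (2 * a) * X + C b := by
  simp only [derivative_add, derivative_mul, derivative_C, zero_mul, derivative_X_pow, derivative_X,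
    mul_one, zero_add, add_zero, map_mul]
  norm_num
  ring

end CensusArithmetic

end Summit.ResolutionOfSingularities.ResolutionOfSingularities.Cruxes.DescentPerfectToAll.NegationLens6g7
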